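import Summits.SmoothPoincare4.SmoothPoincare4.Theses.IsotropicCorkBracketing
import Literature.Geometry.Riemannian.RoundSphereProofs
import Literature.Geometry.Lorentzian.CurvatureNaturality
import Literature.Geometry.Lorentzian.IsometryProofs
import Literature.Geometry.Lorentzian.LeviCivitaProofs
import Literature.Geometry.Lorentzian.GreenIdentity
import Literature.Geometry.Lorentzian.ChartLaplacian
import Literature.Geometry.Lorentzian.EnergyCurrents
import Literature.Geometry.Riemannian.RiemannianDistance

/-!
# Route IsotropicCorkBracketing — support item `RoundPullback` (stmt-SmoothPoincare4-9831)

A closed smooth 4-manifold `P` diffeomorphic to the unit sphere `S⁴ ⊂ ℝ⁵` carries a Riemannian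
metric — the round metric pulled back along the diffeomorphism `Φ : P ≃ₘ S⁴` — whose isotropic
curvature is identically `4` on orthonormal 4-frames (`R(X,Y)Z = g(Y,Z)X - g(X,Z)Y`, O'Neill 1983,
Ch. 3, Prop. 3.59 with Lee 2018, Thm. 8.34 (b); Micallef–Moore 1988, §1), so that with `μ ≡ 4`
and `c = 12` its Chen–Zhu isotropic form is Neumann-positive on every measurable subset `S ⊆ P`:
`12 ∫_S u² ≤ ∫_S (6 |∇u|² + 12 u²)` for all `u ∈ C¹(P)` (`|∇u|² ≥ 0`, and both integrands are
continuous, hence integrable for the finite Riemannian measure of the compact manifold `P`).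

Everything is assembled from proved results of the tree: the round metric and its curvature
(`Literature.Geometry.Riemannian.curvature_roundMetric`), the pullback metric
(`PseudoRiemannianMetric.comap`, smoothness `contMDiff_pullbackBilin_holds`), naturality of the
Riemann tensor under local diffeomorphisms (`PseudoRiemannianMetric.riemann_comap_apply`), the
fundamental lemma (`hasLeviCivita`, `isLeviCivita_leviCivita_holds`), continuity of `g⁻¹(du, du)`
(`continuous_innerDual_mvfderiv`) and finiteness of the Riemannian measure on compact manifolds
(`integrable_of_continuous`).
-/

set_option linter.dupNamespace false

noncomputable section

open Bundle Set Function MeasureTheory Metric Module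
open scoped Manifold ContDiff Topology

namespace Summit.SmoothPoincare4.SmoothPoincare4.Theorems

open Literature.Geometry.Lorentzian Literature.Geometry.Lorentzian.PseudoRiemannianMetric
  Literature.Geometry.Riemannian

/-- **The isotropic curvature of a constant-curvature-`1` tensor is `4`.** If a connection `cov`
on `TM` has curvature `R(X,Y)Z = G(Y,Z)X - G(X,Z)Y` at `x` (the curvature tensor of the unit
sphere, Lee 2018, Thm. 8.34 (b) with Prop. 8.36), then for every `G`-orthonormal 4-frame `e` at
`x` the Micallef–Moore isotropic curvature `K₁₃ + K₁₄ + K₂₃ + K₂₄ - 2R₁₂₃₄` equals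
`1 + 1 + 1 + 1 - 0 = 4`. Micallef–Moore 1988, §1. -/
theorem isotropicCurvature_eq_four_of_curvature_eq
    {E : Type*} [NormedAddCommGroup E] [NormedSpace ℝ E] {H : Type*} [TopologicalSpace H]
    {I : ModelWithCorners ℝ E H} {M : Type*} [TopologicalSpace M] [ChartedSpace H M]
    [IsManifold I ∞ M] {n : ℕ∞ω}
    (G : PseudoRiemannianMetric I n E (TangentSpace I : M → Type _))
    (cov : CovariantDerivative I E (TangentSpace I : M → Type _)) {x : M}
    (hR : ∀ X Y Z : TangentSpace I x, cov.curvature x X Y Z = G.val x Y Z • X - G.val x X Z • Y)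
    {e : Fin 4 → TangentSpace I x} (he : G.IsOrthonormalFrame x e) :
    G.isotropicCurvature cov x e = 4 := by
  obtain ⟨h1, h2⟩ := he
  simp only [isotropicCurvature, curvatureForm, hR, map_sub, map_smul, sub_apply,
    FunLike.coe_smul, Pi.smul_apply, smul_eq_mul,
    h1 0, h1 1, h1 2, h1 3, h2 0 2 (by decide), h2 2 0 (by decide), h2 0 3 (by decide),
    h2 3 0 (by decide), h2 1 2 (by decide), h2 2 1 (by decide), h2 1 3 (by decide),
    h2 3 1 (by decide)]
  norm_num

/-- **Neumann positivity of the isotropic form with `μ ≡ 4`, `c = 12`.** For a smooth Riemannian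
metric `G` on a closed manifold `P` (modelled on `ℝᵐ`), every measurable `S ⊆ P` and every
`u ∈ C¹(P)`: `12 ∫_S u² dV_G ≤ ∫_S (6 |∇u|²_G + 3·4·u²) dV_G`. Indeed `|∇u|²_G = G⁻¹(du, du) ≥ 0`
pointwise, and both `u²` and `|∇u|²_G` are continuous (`continuous_innerDual_mvfderiv`), hence
integrable for the finite Riemannian measure of the compact manifold (`integrable_of_continuous`),
so the right-hand side splits as `6 ∫_S |∇u|² + 12 ∫_S u²`. [folklore] -/
theorem twelve_mul_setIntegral_sq_le_setIntegral_isotropicForm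
    {m : ℕ} {P : Type*} [TopologicalSpace P] [T2Space P] [CompactSpace P]
    [ChartedSpace (EuclideanSpace ℝ (Fin m)) P] [IsManifold (𝓡 m) ∞ P]
    [MeasurableSpace P] [BorelSpace P]
    (G : PseudoRiemannianMetric (𝓡 m) ∞ (EuclideanSpace ℝ (Fin m)) (TangentSpace (𝓡 m) : P → Type _))
    (hG : G.IsRiemannian) {S : Set P} (hS : MeasurableSet S) {u : P → ℝ}
    (hu : ContMDiff (𝓡 m) 𝓘(ℝ, ℝ) 1 u) :
    12 * ∫ x in S, u x ^ 2 ∂(riemannianMeasure (G.toContMDiffRiemannianMetric hG)) ≤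
      ∫ x in S, (6 * G.gradSq u x + 3 * 4 * u x ^ 2)
        ∂(riemannianMeasure (G.toContMDiffRiemannianMetric hG)) := by
  set ν : Measure P := riemannianMeasure (G.toContMDiffRiemannianMetric hG) with hν
  have hval_nonneg : ∀ (x : P) (v : TangentSpace (𝓡 m) x), 0 ≤ G.val x v v := by
    intro x v
    rcases eq_or_ne v 0 with rfl | hv
    · exact (show G.val x (0 : TangentSpace (𝓡 m) x) 0 = 0 by rw [map_zero]).ge
    · exact (hG x v hv).le
  have hgs_nonneg : ∀ x, 0 ≤ G.gradSq u x := fun x ↦ by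
    rw [gradSq, innerDual_eq_val_sharp_sharp]
    exact hval_nonneg x _
  have hcu : Continuous fun x ↦ u x ^ 2 := hu.continuous.pow 2
  have hcg : Continuous (G.gradSq u) := continuous_innerDual_mvfderiv G hu hu
  have hi1 : Integrable (fun x ↦ u x ^ 2) ν :=
    integrable_of_continuous (G.toContMDiffRiemannianMetric hG) hcu
  have hi2 : Integrable (G.gradSq u) ν :=
    integrable_of_continuous (G.toContMDiffRiemannianMetric hG) hcg
  have heq : (fun x ↦ 6 * G.gradSq u x + 3 * 4 * u x ^ 2) =
      fun x ↦ 6 * G.gradSq u x + 12 * u x ^ 2 := by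
    funext x
    ring
  have hsplit : ∫ x in S, (6 * G.gradSq u x + 3 * 4 * u x ^ 2) ∂ν =
      6 * ∫ x in S, G.gradSq u x ∂ν + 12 * ∫ x in S, u x ^ 2 ∂ν := by
    rw [heq, integral_add ((hi2.const_mul 6).integrableOn) ((hi1.const_mul 12).integrableOn),
      integral_const_mul, integral_const_mul]
  have hnn : 0 ≤ ∫ x in S, G.gradSq u x ∂ν := setIntegral_nonneg hS fun x _ ↦ hgs_nonneg x
  rw [hsplit]
  linarith

/-- **Round pullback** (item `RoundPullback` of route `IsotropicCorkBracketing`): a closed smooth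
4-manifold `P` diffeomorphic to `S⁴` carries a Riemannian metric `G` (the pulled-back round
metric, isotropic curvature `≡ 4`) with Levi-Civita connection such that for every measurable
`S ⊆ P`, with `μ ≡ 4` (a continuous lower bound of the isotropic curvatures of `G` on orthonormal
4-frames) and `c = 12`, `c ∫_S u² dV_G ≤ ∫_S (6 |∇u|²_G + 3 μ u²) dV_G` for all `u ∈ C¹(P)`.
O'Neill 1983, Ch. 3, Prop. 3.59 (isometries preserve curvature); Lee 2018, Thm. 8.34 (b)
(the unit sphere has constant curvature `1`); Micallef–Moore 1988, §1 (isotropic curvature of a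
frame). -/
theorem roundPullback_proof :
    Summit.SmoothPoincare4.SmoothPoincare4.Theses.IsotropicCorkBracketing.RoundPullback := by
  intro P _ _ _ _ _ _ _ _ hP
  obtain ⟨Φ⟩ := hP
  -- the round metric on `S⁴ ⊂ ℝ⁵`
  haveI hfact : Fact (finrank ℝ (EuclideanSpace ℝ (Fin 5)) = 4 + 1) := ⟨finrank_euclideanSpace_fin⟩
  set g : PseudoRiemannianMetric (𝓡 4) ∞ (EuclideanSpace ℝ (Fin 4))
      (TangentSpace (𝓡 4) : sphere (0 : EuclideanSpace ℝ (Fin 5)) 1 → Type _) :=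
    roundMetric (n := 4) (EuclideanSpace ℝ (Fin 5)) with hg_def
  haveI : g.HasLeviCivita := g.hasLeviCivita
  have hLCg : g.IsLeviCivita g.leviCivita := isLeviCivita_leviCivita_holds (g := g)
  -- the diffeomorphism and its differentials
  have hΦ : ContMDiff (𝓡 4) (𝓡 4) (∞ + 1) Φ := Φ.contMDiff
  have hΦ' : ∀ x, Function.Injective (mfderiv (𝓡 4) (𝓡 4) Φ x) := fun x ↦
    (Φ.mfderivToContinuousLinearEquiv (by simp) x).injective
  have hdim : finrank ℝ (EuclideanSpace ℝ (Fin 4)) = finrank ℝ (EuclideanSpace ℝ (Fin 4)) := rfl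
  have hinv : ∀ (x : P) (v : TangentSpace (𝓡 4) x),
      (mfderiv (𝓡 4) (𝓡 4) Φ x).inverse (mfderiv (𝓡 4) (𝓡 4) Φ x v) = v := by
    intro x v
    rw [← Diffeomorph.mfderivToContinuousLinearEquiv_coe Φ (by simp),
      ContinuousLinearMap.inverse_equiv]
    exact (Φ.mfderivToContinuousLinearEquiv _ x).symm_apply_apply v
  -- the pulled-back metric
  set G : PseudoRiemannianMetric (𝓡 4) ∞ (EuclideanSpace ℝ (Fin 4))
      (TangentSpace (𝓡 4) : P → Type _) :=
    g.comap (contMDiff_pullbackBilin_holds (I := 𝓡 4) (M := sphere (0 : EuclideanSpace ℝ (Fin 5)) 1)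
      (I' := 𝓡 4) (N := P)) Φ hΦ hΦ' hdim with hG_def
  haveI hGLC : G.HasLeviCivita := G.hasLeviCivita
  have hGval : ∀ (x : P) (v w : TangentSpace (𝓡 4) x),
      G.val x v w = g.val (Φ x) (mfderiv (𝓡 4) (𝓡 4) Φ x v) (mfderiv (𝓡 4) (𝓡 4) Φ x w) := by
    intro x v w
    rw [hG_def, val_comap, pullbackBilin_apply]
  have hG : G.IsRiemannian := by
    intro x v hv
    rw [hGval]
    exact isRiemannian_roundMetric (Φ x) _ fun h0 ↦ hv (hΦ' x (by rw [h0, map_zero]))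
  -- the curvature of the pulled-back metric: `R(X,Y)Z = G(Y,Z)X - G(X,Z)Y`
  have hR : ∀ (x : P) (X Y Z : TangentSpace (𝓡 4) x),
      G.leviCivita.curvature x X Y Z = G.val x Y Z • X - G.val x X Z • Y := by
    intro x X Y Z
    have h1 := riemann_comap_apply g (contMDiff_pullbackBilin_holds (I := 𝓡 4)
      (M := sphere (0 : EuclideanSpace ℝ (Fin 5)) 1) (I' := 𝓡 4) (N := P)) hΦ hΦ' hdim x X Y Z
    change G.riemann x X Y Z = _
    rw [h1]
    change (mfderiv (𝓡 4) (𝓡 4) Φ x).inverse (g.leviCivita.curvature (Φ x) _ _ _) = _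
    rw [curvature_roundMetric hLCg (Φ x), map_sub, map_smul, map_smul, hinv, hinv, hGval, hGval]
  -- assemble: `μ ≡ 4`, `c = 12`
  clear_value G
  exact ⟨G, hG, hGLC, fun S hS ↦ ⟨12, by norm_num, fun _ ↦ 4, continuous_const,
    fun x e he ↦ (isotropicCurvature_eq_four_of_curvature_eq G G.leviCivita (hR x) he).ge,
    fun u hu ↦ twelve_mul_setIntegral_sq_le_setIntegral_isotropicForm G hG hS hu⟩⟩

end Summit.SmoothPoincare4.SmoothPoincare4.Theorems

end
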